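import Literature.NumberTheory.Sieve.LinearEquationsInPrimesGowersCyclic
import HarnessLib

/-!
# Odd-order logarithmic Chowla (Tao–Teräväinen 2018): the generalised von Neumann step

Topic `Literature/NumberTheory/Sieve`; first support file towards the named fact
`Literature.NumberTheory.Sieve.liouville_logCorrelation_isLittleO_of_odd` (**parity.S22**,
`ParityWave0.lean`): T. Tao, J. Teräväinen, *Odd order cases of the logarithmically averaged
Chowla conjecture*, J. Théor. Nombres Bordeaux 30 (2018), 997–1015 (arXiv:1710.02112).
Everything here is PROVED; no definitions, no named facts.

The printed proof of Theorem 1.1 (§3 there) combines Theorem 3.1 (an approximate functional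
equation from the entropy decrement argument) with Theorem 3.2 (comparison of prime and integer
dilates), and Theorem 3.2 rests on two lemmas: **Lemma 5.2**, a generalised von Neumann theorem
"uniform in the `W`-aspect", and Lemma 5.3, the Gowers uniformity of the `W`-tricked von
Mangoldt function (Green–Tao 2010, Thm. 7.2 — the tree's named fact
`Literature.NumberTheory.Sieve.GreenTao2010_gowersUniformity`). This file proves Lemma 5.2 in
the form the comparison theorem needs for the correlations `λ(n + h₁ d) ⋯ λ(n + h_k d)` of the
fact (coefficients `a_j = 1`; after splitting into residue classes the modulus is gone and both
variables range over `[H]`):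

* `OddLogChowla.abs_sum_dilated_le` — for `θ : ℤ → ℝ`, `1`-bounded `φ_j`, shifts `h_j ≤ B`
  one of which vanishes, and `H ≥ 1`,
  `|∑_{d=1}^{H} ∑_{n=1}^{H} θ(d) ∏_j φ_j(n + h_j d)| ≤ ((B+3)H)² ‖θ‖_{U^k[H]}`
  with the local Gowers norm `Literature.NumberTheory.Sieve.uniformityNorm` of Green–Tao 2010,
  (B.11) (`LinearEquationsInPrimesTransference.lean`), i.e. the norm in which
  `GreenTao2010_gowersUniformity` is stated.

The proof is the printed one: move to the cyclic group `ℤ_M`, `M = (B+3)H`, extending `θ` by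
zero (`OddLogChowla.sum_dilated_eq_sum_zmod`; the vanishing shift lets the factor `φ_{i₀}` carry
the cutoff `1_{[H]}(n)`, so no Fourier expansion of a cutoff is needed); change variables
`d = x₁ + ⋯ + x_k`, `n = n' - ∑_l h_l x_l`, after which the `j`-th factor is independent of `x_j`
(`OddLogChowla.expect_linearChange`, `OddLogChowla.linearChange_arg`); apply the
Gowers–Cauchy–Schwarz inequality of the tree (`Literature.NumberTheory.Sieve.gowersCauchySchwarz`,
Green–Tao 2010, Lemma B.2) to the vertex family "`Θ(∑ x)` on top, `Ψ_j` at `univ ∖ {j}`, `1`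
elsewhere" (`OddLogChowla.abs_expect_mul_prod_pow_le_gowersPower`); and compare
`‖θ 1_{[H]}‖_{U^k(ℤ_M)} ≤ ‖θ‖_{U^k[H]}` (`gowersPower_extendByZero_le`, Green–Tao 2010, Lemma B.5).
The constant `((B+3)H)²/H²` is explicit; the printed `o_{N → ∞}(1)` term does not arise in this
special case.

## References
* T. Tao, J. Teräväinen, J. Théor. Nombres Bordeaux 30 (2018), no. 3, 997–1015, §5, Lemma 5.2
  and its proof (arXiv:1710.02112). [TaoTeravainenJTNB2018]
* B. Green, T. Tao, *Linear equations in primes*, Ann. of Math. 171 (2010), App. B (Lemma B.2,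
  Lemma B.5). [GreenTao2010]
-/

noncomputable section

open Finset
open scoped BigOperators

namespace Literature.NumberTheory.Sieve

namespace OddLogChowla

section boxes

variable {ι X : Type*} [DecidableEq ι] [Fintype ι] [Fintype X] [Nonempty X]

/-- `‖g‖_{□^A}^{2^{|A|}} ≤ 1` for a `1`-bounded `g`. [folklore] -/
theorem boxPower_le_one_of_abs_le (A : Finset ι) {g : (ι → X) → ℝ} (hg : ∀ x, |g x| ≤ 1) :
    boxPower A g ≤ 1 := by
  unfold boxPower boxProd
  refine (le_abs_self _).trans ((Finset.abs_expect_le _ _).trans ?_)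
  refine (Finset.expect_le_expect fun p _ => ?_).trans
    (by rw [Finset.expect_const Finset.univ_nonempty])
  rw [Finset.abs_prod]
  exact Finset.prod_le_one (fun _ _ => abs_nonneg _) fun ω _ => hg _

end boxes

section gcs

variable {M : ℕ} {k : ℕ}

/-- `x^{(univ)} = x⁽¹⁾`. [folklore] -/
theorem mixPt_univ (x₀ x₁ : Fin k → ZMod M) : mixPt x₀ x₁ (Finset.univ : Finset (Fin k)) = x₁ := by
  funext a; simp [mixPt]

/-- `x^{(univ ∖ {j})}` is `x⁽¹⁾` with the `j`-th coordinate replaced by `x⁽⁰⁾_j`. [folklore] -/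
theorem mixPt_erase (x₀ x₁ : Fin k → ZMod M) (j : Fin k) :
    mixPt x₀ x₁ (Finset.univ.erase j) = Function.update x₁ j (x₀ j) := by
  funext a
  by_cases h : a = j
  · subst h; simp [mixPt]
  · rw [Function.update_of_ne h, mixPt_of_mem (Finset.mem_erase.mpr ⟨h, Finset.mem_univ a⟩)]

/-- **The box product of a GCS vertex family.** Let `F_ω`, `ω ⊆ [k]`, be `Θ(∑ x)` at the top
vertex, `Ψ_j` at the vertex `[k] ∖ {j}` and `1` at every other vertex, where each `Ψ_j` ignores
the `j`-th coordinate. Then the box product of the family at a pair `(x⁽⁰⁾, x⁽¹⁾)` is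
`Θ(∑ x⁽¹⁾) ∏_j Ψ_j(x⁽¹⁾)`. [cite: TaoTeravainenJTNB2018, proof of Lemma 5.2] -/
theorem boxProd_family (Θ : ZMod M → ℝ) {Ψ : Fin k → (Fin k → ZMod M) → ℝ}
    (hΨ : ∀ j x v, Ψ j (Function.update x j v) = Ψ j x)
    {F : Finset (Fin k) → (Fin k → ZMod M) → ℝ} (hFu : F Finset.univ = fun x => Θ (∑ l, x l))
    (hFe : ∀ j, F (Finset.univ.erase j) = Ψ j)
    (hF1 : ∀ ω, ω ≠ Finset.univ → (∀ j, ω ≠ Finset.univ.erase j) → F ω = fun _ => 1)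
    (p : (Fin k → ZMod M) × (Fin k → ZMod M)) :
    boxProd Finset.univ F p = Θ (∑ l, p.2 l) * ∏ j, Ψ j p.2 := by
  classical
  unfold boxProd
  set T : Finset (Finset (Fin k)) := insert Finset.univ (Finset.univ.image fun j : Fin k =>
    Finset.univ.erase j) with hT
  have hsub : T ⊆ (Finset.univ : Finset (Fin k)).powerset := fun ω _ =>
    Finset.mem_powerset.mpr (Finset.subset_univ ω)
  rw [← Finset.prod_subset hsub]
  · have hnot : (Finset.univ : Finset (Fin k)) ∉
        Finset.univ.image fun j : Fin k => Finset.univ.erase j := by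
      intro h
      obtain ⟨j, _, hj⟩ := Finset.mem_image.mp h
      have := hj ▸ Finset.notMem_erase j Finset.univ
      exact this (Finset.mem_univ j)
    rw [hT, Finset.prod_insert hnot, mixPt_univ]
    have hinj : Set.InjOn (fun j : Fin k => Finset.univ.erase j) (Finset.univ : Finset (Fin k)) := by
      intro j _ j' _ hjj'
      have hjj : Finset.univ.erase j = Finset.univ.erase j' := hjj'
      by_contra hne
      have : j' ∈ Finset.univ.erase j := Finset.mem_erase.mpr ⟨Ne.symm hne, Finset.mem_univ _⟩
      rw [hjj] at this
      exact Finset.notMem_erase j' _ this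
    rw [Finset.prod_image hinj]
    congr 1
    · rw [hFu]
    · refine Finset.prod_congr rfl fun j _ => ?_
      rw [hFe, mixPt_erase, hΨ]
  · intro ω _ hω
    have hω1 : ω ≠ Finset.univ := fun h => hω (h ▸ Finset.mem_insert_self _ _)
    have hω2 : ∀ j, ω ≠ Finset.univ.erase j := fun j h =>
      hω (Finset.mem_insert_of_mem (Finset.mem_image.mpr ⟨j, Finset.mem_univ _, h.symm⟩))
    rw [hF1 ω hω1 hω2]

/-- **Gowers–Cauchy–Schwarz for one unbounded function of the sum**: if `|Ψ_j| ≤ 1` and `Ψ_j`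
does not depend on the `j`-th coordinate, then
`|𝔼_{x ∈ ℤ_M^k} Θ(x₁ + ⋯ + x_k) ∏_j Ψ_j(x)|^{2^k} ≤ ‖Θ‖_{U^k(ℤ_M)}^{2^k}`.
[cite: TaoTeravainenJTNB2018, proof of Lemma 5.2 (the Gowers–Cauchy–Schwarz step)] -/
theorem abs_expect_mul_prod_pow_le_gowersPower [NeZero M] (hk : 1 ≤ k) (Θ : ZMod M → ℝ)
    {Ψ : Fin k → (Fin k → ZMod M) → ℝ} (hΨ1 : ∀ j x, |Ψ j x| ≤ 1)
    (hΨ : ∀ j x v, Ψ j (Function.update x j v) = Ψ j x) :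
    |𝔼 x : Fin k → ZMod M, Θ (∑ l, x l) * ∏ j, Ψ j x| ^ (2 ^ k) ≤ gowersPower k Θ := by
  classical
  have hA : (Finset.univ : Finset (Fin k)).Nonempty := ⟨⟨0, hk⟩, Finset.mem_univ _⟩
  -- the vertex family: `Θ(∑ x)` on top, `Ψ_j` at `univ ∖ {j}`, `1` elsewhere
  set F : Finset (Fin k) → (Fin k → ZMod M) → ℝ := fun ω x =>
    if ω = Finset.univ then Θ (∑ l, x l)
    else ∏ j ∈ Finset.univ \ ω, if ω = Finset.univ.erase j then Ψ j x else 1 with hF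
  have hne : ∀ j : Fin k, Finset.univ.erase j ≠ (Finset.univ : Finset (Fin k)) := fun j h => by
    have := h ▸ Finset.notMem_erase j Finset.univ
    exact this (Finset.mem_univ j)
  have hFu : F Finset.univ = fun x => Θ (∑ l, x l) := by funext x; simp [hF]
  have hFe : ∀ j, F (Finset.univ.erase j) = Ψ j := by
    intro j; funext x
    have hsd : Finset.univ \ Finset.univ.erase j = ({j} : Finset (Fin k)) := by ext a; simp
    simp only [hF, if_neg (hne j), hsd, Finset.prod_singleton, ite_true]
  have hF1 : ∀ ω, ω ≠ Finset.univ → (∀ j, ω ≠ Finset.univ.erase j) → F ω = fun _ => 1 := by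
    intro ω hω hω'; funext x
    simp only [hF, if_neg hω]
    exact Finset.prod_eq_one fun j _ => if_neg (hω' j)
  have hFb : ∀ ω, ω ≠ Finset.univ → ∀ x, |F ω x| ≤ 1 := by
    intro ω hω x
    simp only [hF, if_neg hω, Finset.abs_prod]
    refine Finset.prod_le_one (fun _ _ => abs_nonneg _) fun j _ => ?_
    split_ifs
    · exact hΨ1 j x
    · simp
  have h1 : (𝔼 x : Fin k → ZMod M, Θ (∑ l, x l) * ∏ j, Ψ j x) =
      𝔼 p : (Fin k → ZMod M) × (Fin k → ZMod M), boxProd Finset.univ F p := by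
    simp_rw [boxProd_family Θ hΨ hFu hFe hF1]
    exact (expect_prod_snd (fun x : Fin k → ZMod M => Θ (∑ l, x l) * ∏ j, Ψ j x)).symm
  have h2 := gowersCauchySchwarz hA F (X := ZMod M)
  rw [Finset.card_univ, Fintype.card_fin] at h2
  rw [h1]
  refine h2.trans ?_
  rw [← Finset.mul_prod_erase _ _ (Finset.mem_powerset.mpr (subset_refl _)), hFu,
    ← gowersPower_eq_boxPower hk Θ]
  refine mul_le_of_le_one_right (gowersPower_nonneg hk Θ) ?_
  refine Finset.prod_le_one (fun ω _ => boxPower_nonneg hA _) fun ω hω => ?_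
  exact boxPower_le_one_of_abs_le _ (hFb ω (Finset.ne_of_mem_erase hω))

end gcs


section cov

variable {M : ℕ} [NeZero M] {k : ℕ}

/-- **Change of variables** `d = x₁ + ⋯ + x_k`, `n = n' - ∑ h_l x_l`: averaging `G(d, n)` over
`ℤ_M²` is averaging `G(∑ x_l, n' - ∑ h_l x_l)` over `(x, n') ∈ ℤ_M^k × ℤ_M` (`k ≥ 1`).
[cite: TaoTeravainenJTNB2018, proof of Lemma 5.2 (change of variables)] -/
theorem expect_linearChange (hk : 1 ≤ k) (h : Fin k → ZMod M) (G : ZMod M → ZMod M → ℝ) :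
    (𝔼 q : (Fin k → ZMod M) × ZMod M, G (∑ l, q.1 l) (q.2 - ∑ l, h l * q.1 l)) =
      𝔼 p : ZMod M × ZMod M, G p.1 p.2 := by
  rw [expect_prod_eq, expect_prod_eq]
  have h1 : ∀ x : Fin k → ZMod M,
      (𝔼 n' : ZMod M, G (∑ l, x l) (n' - ∑ l, h l * x l)) = 𝔼 n, G (∑ l, x l) n := fun x =>
    expect_comp_equiv (Equiv.subRight (∑ l, h l * x l)) (G (∑ l, x l))
  simp_rw [h1]
  have h2 := expect_linear_uniform (fun d => 𝔼 n, G d n) (0 : ZMod M)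
    (a := fun _ : Fin k => (1 : ZMod M)) (j₀ := ⟨0, hk⟩) isUnit_one
  simpa only [one_mul, zero_add] using h2

omit [NeZero M] in
/-- The dilated-shift average over `ℤ_M²` after the change of variables: the `j`-th factor
becomes `Φ_j(n' + ∑_{l ≠ j} (h_j - h_l) x_l)`, independent of `x_j`. [folklore] -/
theorem linearChange_arg (h : Fin k → ZMod M) (x : Fin k → ZMod M) (n' : ZMod M) (j : Fin k) :
    n' - ∑ l, h l * x l + h j * ∑ l, x l = n' + ∑ l ∈ Finset.univ.erase j, (h j - h l) * x l := by
  have h1 : ∑ l ∈ Finset.univ.erase j, (h j - h l) * x l = ∑ l, (h j - h l) * x l :=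
    Finset.sum_erase _ (by ring)
  have h2 : ∑ l, (h j - h l) * x l = ∑ l, h j * x l - ∑ l, h l * x l := by
    rw [← Finset.sum_sub_distrib]
    exact Finset.sum_congr rfl fun l _ => by ring
  rw [h1, h2, Finset.mul_sum]
  ring

/-- **Generalised von Neumann bound on `ℤ_M`** (Tao–Teräväinen JTNB 2018, Lemma 5.2, cyclic
form for the system `(d, n + h₁ d, …, n + h_k d)`): for `1`-bounded `Φ_j`,
`|𝔼_{d,n ∈ ℤ_M} Θ(d) ∏_j Φ_j(n + h_j d)| ≤ u` whenever `‖Θ‖_{U^k(ℤ_M)}^{2^k} ≤ u^{2^k}`, `u ≥ 0`.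
[cite: TaoTeravainenJTNB2018, Lemma 5.2 and its proof] -/
theorem abs_expect_dilated_le (hk : 1 ≤ k) (h : Fin k → ZMod M) (Θ : ZMod M → ℝ)
    {Φ : Fin k → ZMod M → ℝ} (hΦ : ∀ j y, |Φ j y| ≤ 1) {u : ℝ} (hu : 0 ≤ u)
    (hΘ : gowersPower k Θ ≤ u ^ (2 ^ k)) :
    |𝔼 p : ZMod M × ZMod M, Θ p.1 * ∏ j, Φ j (p.2 + h j * p.1)| ≤ u := by
  set G : ZMod M → ZMod M → ℝ := fun d n => Θ d * ∏ j, Φ j (n + h j * d) with hG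
  have h0 : (𝔼 p : ZMod M × ZMod M, Θ p.1 * ∏ j, Φ j (p.2 + h j * p.1)) =
      𝔼 p : ZMod M × ZMod M, G p.1 p.2 := rfl
  rw [h0, ← expect_linearChange hk h G, expect_prod_eq']
  -- for each `n'`, the inner average is a Gowers–Cauchy–Schwarz configuration
  set Ψ : ZMod M → Fin k → (Fin k → ZMod M) → ℝ :=
    fun n' j x => Φ j (n' + ∑ l ∈ Finset.univ.erase j, (h j - h l) * x l) with hΨ
  have hinner : ∀ n' : ZMod M, (𝔼 x : Fin k → ZMod M, G (∑ l, x l) (n' - ∑ l, h l * x l)) =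
      𝔼 x : Fin k → ZMod M, Θ (∑ l, x l) * ∏ j, Ψ n' j x := by
    intro n'
    refine Finset.expect_congr rfl fun x _ => ?_
    simp only [hG, hΨ]
    congr 1
    exact Finset.prod_congr rfl fun j _ => by rw [linearChange_arg h x n' j]
  simp_rw [hinner]
  have hbound : ∀ n' : ZMod M, |𝔼 x : Fin k → ZMod M, Θ (∑ l, x l) * ∏ j, Ψ n' j x| ≤ u := by
    intro n'
    have h1 := abs_expect_mul_prod_pow_le_gowersPower hk Θ (Ψ := Ψ n') (fun j x => hΦ j _)
      (fun j x v => by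
        simp only [hΨ]
        congr 2
        exact Finset.sum_congr rfl fun l hl => by
          rw [Function.update_of_ne (Finset.ne_of_mem_erase hl)])
    exact (pow_le_pow_iff_left₀ (abs_nonneg _) hu (pow_ne_zero k two_ne_zero)).mp (h1.trans hΘ)
  calc |𝔼 n' : ZMod M, 𝔼 x : Fin k → ZMod M, Θ (∑ l, x l) * ∏ j, Ψ n' j x|
      ≤ 𝔼 n' : ZMod M, |𝔼 x : Fin k → ZMod M, Θ (∑ l, x l) * ∏ j, Ψ n' j x| :=
        Finset.abs_expect_le _ _
    _ ≤ 𝔼 n' : ZMod M, u := Finset.expect_le_expect fun n' _ => hbound n'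
    _ = u := Finset.expect_const Finset.univ_nonempty u

end cov

section embed

variable {k : ℕ}

/-- Residues of small natural numbers: `(m : ℤ_M).val = m` for `m < M`. [folklore] -/
theorem val_natCast_of_lt {M m : ℕ} [NeZero M] (hm : m < M) : ((m : ZMod M)).val = m := by
  rw [ZMod.val_natCast, Nat.mod_eq_of_lt hm]

/-- **Moving to a cyclic group `ℤ_M`, `M > (B+1)H`**: the dilated-shift double sum over
`[H]²` equals the full sum over `ℤ_M²` of the extensions (no wraparound since
`n + h_j d ≤ (B+1)H < M`; the cutoff in `d` is carried by `θ 1_{[H]}`, the cutoff in `n` by the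
factor `j = i₀` with `h_{i₀} = 0`). [cite: TaoTeravainenJTNB2018, proof of Lemma 5.2] -/
theorem sum_dilated_eq_sum_zmod (h : Fin k → ℕ) {i₀ : Fin k} (hi₀ : h i₀ = 0) {B : ℕ}
    (hB : ∀ j, h j ≤ B) (θ : ℤ → ℝ) (φ : Fin k → ℕ → ℝ) {H M : ℕ} [NeZero M]
    (hM : (B + 1) * H < M) :
    ∑ d ∈ Finset.Icc 1 H, ∑ n ∈ Finset.Icc 1 H, θ d * ∏ j, φ j (n + h j * d) =
      ∑ p : ZMod M × ZMod M, extendByZero M H θ p.1 *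
        ∏ j, (if j = i₀ then extendByZero M H (fun z => φ j z.toNat) (p.2 + (h j : ZMod M) * p.1)
          else φ j (p.2 + (h j : ZMod M) * p.1).val) := by
  have hHM : H < M := by nlinarith
  classical
  rw [← Finset.sum_product']
  refine Finset.sum_of_injOn (fun q : ℕ × ℕ => ((q.1 : ZMod M), (q.2 : ZMod M))) ?_ ?_ ?_ ?_
  · -- injectivity on `[H]²`
    intro q hq q' hq' hqq'
    simp only [Finset.coe_product, Set.mem_prod, Finset.mem_coe, Finset.mem_Icc] at hq hq'
    simp only [Prod.mk.injEq] at hqq'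
    have h1 := congrArg ZMod.val hqq'.1
    have h2 := congrArg ZMod.val hqq'.2
    rw [val_natCast_of_lt (by omega), val_natCast_of_lt (by omega)] at h1 h2
    exact Prod.ext h1 h2
  · intro q _
    simp
  · -- terms off the image vanish
    intro p _ hp
    by_contra hne
    have hθ : extendByZero M H θ p.1 ≠ 0 := fun h0 => hne (by rw [h0, zero_mul])
    have hd := extendByZero_ne_zero hθ
    have hprod : ∏ j, (if j = i₀ then
        extendByZero M H (fun z => φ j z.toNat) (p.2 + (h j : ZMod M) * p.1)
          else φ j (p.2 + (h j : ZMod M) * p.1).val) ≠ 0 :=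
      fun h0 => hne (by rw [h0, mul_zero])
    have hi : (if i₀ = i₀ then
        extendByZero M H (fun z => φ i₀ z.toNat) (p.2 + (h i₀ : ZMod M) * p.1)
          else φ i₀ (p.2 + (h i₀ : ZMod M) * p.1).val) ≠ 0 := fun h0 =>
      hprod (Finset.prod_eq_zero (Finset.mem_univ i₀) h0)
    rw [if_pos rfl, hi₀, Nat.cast_zero, zero_mul, add_zero] at hi
    have hn := extendByZero_ne_zero hi
    apply hp
    refine ⟨(p.1.val, p.2.val), ?_, ?_⟩
    · simp only [Finset.coe_product, Set.mem_prod, Finset.mem_coe, Finset.mem_Icc]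
      exact ⟨⟨hd.1, hd.2⟩, hn.1, hn.2⟩
    · simp
  · -- the terms agree on `[H]²`
    intro q hq
    simp only [Finset.mem_product, Finset.mem_Icc] at hq
    obtain ⟨⟨hd1, hdH⟩, hn1, hnH⟩ := hq
    congr 1
    · have := extendByZero_intCast hHM θ (v := (q.1 : ℤ)) (by exact_mod_cast hd1)
        (by exact_mod_cast hdH)
      rw [Int.cast_natCast] at this
      exact this.symm
    · refine Finset.prod_congr rfl fun j _ => ?_
      have hlt : q.2 + h j * q.1 < M := by
        have := hB j
        have : h j * q.1 ≤ B * H := Nat.mul_le_mul this hdH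
        nlinarith
      have hcast : ((q.2 : ZMod M) + (h j : ZMod M) * (q.1 : ZMod M)) =
          ((q.2 + h j * q.1 : ℕ) : ZMod M) := by
        push_cast; ring
      rw [hcast]
      by_cases hj : j = i₀
      · subst hj
        rw [if_pos rfl, hi₀, zero_mul, add_zero]
        have := extendByZero_intCast hHM (fun z => φ j z.toNat) (v := (q.2 : ℤ))
          (by exact_mod_cast hn1) (by exact_mod_cast hnH)
        rw [Int.cast_natCast] at this
        rw [this, Int.toNat_natCast]
      · rw [if_neg hj, val_natCast_of_lt hlt]

end embed

section main

variable {k : ℕ}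

/-- **Generalised von Neumann theorem for dilated shift patterns** (Tao–Teräväinen, JTNB 30
(2018), Lemma 5.2, in the special case `a_j = 1`, `W = 1` needed for correlations of
`λ(n + h₁ d) ⋯ λ(n + h_k d)` with one shift `h_{i₀} = 0`, and with an explicit constant): for any
`θ : ℤ → ℝ`, any `1`-bounded `φ_j : ℕ → ℝ`, shifts `h_j ≤ B` with `h_{i₀} = 0`, and `H ≥ 1`,
`|∑_{d=1}^{H} ∑_{n=1}^{H} θ(d) ∏_j φ_j(n + h_j d)| ≤ ((B+3)H)² ‖θ‖_{U^k[H]}`, where `‖·‖_{U^k[H]}`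
is the local Gowers uniformity norm `Literature.NumberTheory.Sieve.uniformityNorm` (Green–Tao 2010,
(B.11)). Proof as printed: move to `ℤ_M` with `M = (B+3)H`, change variables
`d = x₁ + ⋯ + x_k`, `n = n' - ∑ h_l x_l` so that the `j`-th factor does not depend on `x_j`, apply
the Gowers–Cauchy–Schwarz inequality, and compare `‖θ 1_{[H]}‖_{U^k(ℤ_M)} ≤ ‖θ‖_{U^k[H]}`
(Green–Tao 2010, Lemma B.5). [cite: TaoTeravainenJTNB2018, Lemma 5.2] -/
theorem abs_sum_dilated_le (hk : 1 ≤ k) (h : Fin k → ℕ) {i₀ : Fin k} (hi₀ : h i₀ = 0) {B : ℕ}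
    (hB : ∀ j, h j ≤ B) (θ : ℤ → ℝ) {φ : Fin k → ℕ → ℝ} (hφ : ∀ j m, |φ j m| ≤ 1) {H : ℕ}
    (hH : 1 ≤ H) :
    |∑ d ∈ Finset.Icc 1 H, ∑ n ∈ Finset.Icc 1 H, θ d * ∏ j, φ j (n + h j * d)| ≤
      (((B + 3) * H : ℕ) : ℝ) ^ 2 * uniformityNorm k H (fun n => ((θ n : ℝ) : ℂ)) := by
  set M : ℕ := (B + 3) * H with hMdef
  haveI : NeZero M := ⟨by positivity⟩
  have hM : (B + 1) * H < M := by rw [hMdef]; nlinarith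
  have h2M : 2 * H ≤ M := by rw [hMdef]; nlinarith
  rw [sum_dilated_eq_sum_zmod h hi₀ hB θ φ hM]
  set u : ℝ := uniformityNorm k H (fun n => ((θ n : ℝ) : ℂ)) with hu
  have hu0 : 0 ≤ u := uniformityNorm_nonneg _ _ _
  have hΘ : gowersPower k (extendByZero M H θ) ≤ u ^ (2 ^ k) := gowersPower_extendByZero_le hH h2M θ
  set Φ : Fin k → ZMod M → ℝ := fun j y =>
    if j = i₀ then extendByZero M H (fun z => φ j z.toNat) y else φ j y.val with hΦ
  have hΦb : ∀ j y, |Φ j y| ≤ 1 := by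
    intro j y
    simp only [hΦ, extendByZero]
    split_ifs
    · exact hφ _ _
    · simp
    · exact hφ _ _
  have hE := abs_expect_dilated_le hk (fun j => (h j : ZMod M)) (extendByZero M H θ)
    (Φ := Φ) hΦb hu0 hΘ
  have hcard : (Fintype.card (ZMod M × ZMod M) : ℝ) = ((M : ℕ) : ℝ) ^ 2 := by
    rw [Fintype.card_prod, ZMod.card]; push_cast; ring
  have hsum : ∑ p : ZMod M × ZMod M, extendByZero M H θ p.1 *
        ∏ j, Φ j (p.2 + (h j : ZMod M) * p.1) =
      ((M : ℕ) : ℝ) ^ 2 * 𝔼 p : ZMod M × ZMod M, extendByZero M H θ p.1 *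
        ∏ j, Φ j (p.2 + (h j : ZMod M) * p.1) := by
    rw [Fintype.expect_eq_sum_div_card, hcard, mul_div_cancel₀]
    positivity
  have hsum' : ∑ p : ZMod M × ZMod M, extendByZero M H θ p.1 *
        ∏ j, (if j = i₀ then extendByZero M H (fun z => φ j z.toNat) (p.2 + (h j : ZMod M) * p.1)
          else φ j (p.2 + (h j : ZMod M) * p.1).val) =
      ∑ p : ZMod M × ZMod M, extendByZero M H θ p.1 * ∏ j, Φ j (p.2 + (h j : ZMod M) * p.1) := by
    rfl
  rw [hsum', hsum, abs_mul, abs_of_nonneg (by positivity)]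
  exact mul_le_mul_of_nonneg_left hE (by positivity)

end main

end OddLogChowla

end Literature.NumberTheory.Sieve
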